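import Literature.Analysis.FluidPDE.JiaSverak2014PerturbationSliced
import HarnessLib

/-!
# The perturbed local energy inequality for `v = u - a`, sliced from the initial time, for
# general data (the initial term `∫ |u₀ - a₀|² ψ`)

Analysis/FluidPDE theorem file (no definitions, no named facts). The tree's
`JiaSverak2014.ae_perturbed_energy_slice` (Jia–Šverák 2014, proof of Thm. 3.1; Lemarié-Rieusset
2016, Prop. 14.1 and the "three balances" of Thm. 14.7) compares a local Leray solution `(u, p)`
with a regular flow `(a, p_K, π)` whose datum agrees with `u₀` on the support of the cut-off, so
that the initial term vanishes. This file records the same inequality **without** the agreement of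
the data: for a.e. `s`,

  `∫ |v(s)|²ψ + 2 ∫∫_{(0,s)} |∇v|²ψ ≤ ∫ |u₀ - a₀|²ψ + ∫∫_{(0,s)} (|v|²Δψ + |v|² u·∇ψ + 2(p - p_K) v·∇ψ - 2ψ⟪Da v, v⟫)`,

`v = u - a`, the initial value being attained because both `u(t) → u₀` and `a(t) → a₀` in
`L²_loc` (the abstract slicing lemma `JiaSverak2014.ae_energy_slice_from_initial` already allows
any initial value `L`). It is the energy inequality of the perturbed system
`∂ₜv - Δv + div(v⊗v + a⊗v + v⊗a) + ∇q = 0`, `v(0) = u₀ - a₀` (Lemarié-Rieusset 2016, (14.31), and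
the energy control of p. 525; Seregin 2014, App. B, Thm. 5.10 (B.5.4)) for the difference of a
Leray solution and a mild solution, which the extension step of the local energy theory
(`localEnergySolution_extension_of_memE2`) consumes through a Gronwall argument.

The proof is the tree's, verbatim, except for the initial limit.

## References

* H. Jia, V. Šverák, Invent. Math. 196 (2014) = arXiv:1204.0529, §3, proof of Thm. 3.1 (p. 8).
* P. G. Lemarié-Rieusset, *The Navier–Stokes Problem in the 21st Century* (2016), Prop. 14.1,
  Thm. 14.7, Thm. 14.8 proof Step 2 (p. 525).
* G. Seregin, *Lecture Notes on Regularity Theory for the Navier–Stokes Equations* (2014), App. B,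
  §B.5, Thm. 5.10.
-/

noncomputable section

open MeasureTheory TopologicalSpace Set Function Filter Metric
open _root_.Topology
open scoped ENNReal NNReal RealInnerProductSpace Laplacian

namespace Literature.Analysis.FluidPDE

open JiaSverak2014

/-- `| ‖p‖² - ‖q‖² | ≤ (1 + 1/η)‖p - q‖² + η‖q‖²` for `η > 0` (file-local helper). [folklore] -/
private theorem abs_norm_sq_sub_norm_sq_le_eta {V : Type*} [NormedAddCommGroup V] (p q : V) {η : ℝ} (hη : 0 < η) :
    |‖p‖ ^ 2 - ‖q‖ ^ 2| ≤ (1 + 1 / η) * ‖p - q‖ ^ 2 + η * ‖q‖ ^ 2 := by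
  have h1 : |‖p‖ ^ 2 - ‖q‖ ^ 2| ≤ ‖p - q‖ * (‖p - q‖ + 2 * ‖q‖) := by
    have hpq : |‖p‖ - ‖q‖| ≤ ‖p - q‖ := abs_norm_sub_norm_le p q
    have hsum : ‖p‖ + ‖q‖ ≤ ‖p - q‖ + 2 * ‖q‖ := by
      have := norm_le_norm_add_norm_sub' p q
      have h2 : ‖p‖ ≤ ‖p - q‖ + ‖q‖ := by
        calc ‖p‖ = ‖(p - q) + q‖ := by rw [sub_add_cancel]
          _ ≤ ‖p - q‖ + ‖q‖ := norm_add_le _ _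
      linarith
    rw [sq_sub_sq, abs_mul, abs_of_nonneg (by positivity : (0:ℝ) ≤ ‖p‖ + ‖q‖), mul_comm]
    exact mul_le_mul hpq hsum (by positivity) (norm_nonneg _)
  have h2 : ‖p - q‖ * (2 * ‖q‖) ≤ (1 / η) * ‖p - q‖ ^ 2 + η * ‖q‖ ^ 2 := by
    have hkey : 0 ≤ (η ^ (1:ℕ))⁻¹ * (‖p - q‖ - η * ‖q‖) ^ 2 := by positivity
    have e : (1 / η) * ‖p - q‖ ^ 2 + η * ‖q‖ ^ 2 - ‖p - q‖ * (2 * ‖q‖) = (η ^ (1:ℕ))⁻¹ * (‖p - q‖ - η * ‖q‖) ^ 2 := by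
      field_simp
      ring
    linarith
  calc |‖p‖ ^ 2 - ‖q‖ ^ 2| ≤ ‖p - q‖ * (‖p - q‖ + 2 * ‖q‖) := h1
    _ = ‖p - q‖ ^ 2 + ‖p - q‖ * (2 * ‖q‖) := by ring
    _ ≤ ‖p - q‖ ^ 2 + ((1 / η) * ‖p - q‖ ^ 2 + η * ‖q‖ ^ 2) := add_le_add le_rfl h2
    _ = (1 + 1 / η) * ‖p - q‖ ^ 2 + η * ‖q‖ ^ 2 := by ring

/-- `(a + b)³ ≤ 4 (a³ + b³)` for `a, b ≥ 0` (file-local copy of the private helper of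
`JiaSverak2014PerturbationSliced`). [folklore] -/
private theorem add_pow_three_le_four_mul {a b : ℝ} (ha : 0 ≤ a) (hb : 0 ≤ b) : (a + b) ^ 3 ≤ 4 * (a ^ 3 + b ^ 3) := by
  nlinarith [sq_nonneg (a - b), mul_nonneg ha hb, sq_nonneg (a + b)]

set_option maxHeartbeats 3200000 in
/-- **The local energy inequality for the perturbation, sliced from the initial time, general
data** (Jia–Šverák 2014, proof of Thm. 3.1; Lemarié-Rieusset 2016, Prop. 14.1 / Thm. 14.7 /
(14.31)). Data: a local Leray solution `(u, p)` on `(0,T') × ℝ³` with datum `u₀ ∈ L²` and a weak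
gradient `G` with the bounds of the class; a regular flow `(a, p_K, π)` from a datum `a₀ ∈ L²`
(local Leray on `(0,S₀)`, classical on `(0,S₂)`, `|a| ≤ 2A`, `√t |∇a| ≤ C₁ A`); a smooth `ψ ≥ 0`
supported in a ball. Conclusion: for a.e. `s ∈ (0, min(T', S₀))`, with `v = u - a`,
`∫ |v(s)|²ψ + 2 ∫∫_{(0,s)×ℝ³} |G - Da|²ψ ≤ ∫ |u₀ - a₀|²ψ + ∫∫_{(0,s)×ℝ³} (|v|²Δψ + |v|² u·∇ψ + 2 (p - p_K) v·∇ψ - 2 ψ ⟪Da v, v⟫)`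
(in `ℝ≥0∞`, the dissipation as a lower integral).
[cite: JiaSverak2014, §3 proof of Thm. 3.1 (arXiv p. 8)] [cite: LemarieRieusset2016, Prop. 14.1, Thm. 14.7, (14.31)] -/
theorem ae_perturbed_energy_slice_of_data {T' S₀ S₂ A C₁ : ℝ}
    {u₀ a₀ : (EuclideanSpace ℝ (Fin 3)) → (EuclideanSpace ℝ (Fin 3))} {u a : ℝ → (EuclideanSpace ℝ (Fin 3)) → (EuclideanSpace ℝ (Fin 3))} {p π pK : ℝ → (EuclideanSpace ℝ (Fin 3)) → ℝ}
    {G : ℝ → (EuclideanSpace ℝ (Fin 3)) → (EuclideanSpace ℝ (Fin 3)) →L[ℝ] (EuclideanSpace ℝ (Fin 3))} {x₀ : (EuclideanSpace ℝ (Fin 3))} {ψ : (EuclideanSpace ℝ (Fin 3)) → ℝ}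
    (hT' : 0 < T') (hm₀ : AEStronglyMeasurable u₀ volume) (hu : IsLocalLeraySolutionOn T' 1 u₀ u p)
    (hG : HasWeakSpatialGradientOn (slab (EuclideanSpace ℝ (Fin 3)) (Ioo 0 T') isOpen_Ioo) u G)
    (hGb : ∀ R : ℝ, 0 < R → ∃ C : ℝ≥0, ∀ y : (EuclideanSpace ℝ (Fin 3)),
      ∫⁻ z in Ioo 0 T' ×ˢ ball y R, ENNReal.ofReal (frobeniusNormSq (G z.1 z.2)) ≤ C)
    (hS₀ : 0 < S₀) (hS₀₂ : S₀ ≤ S₂) (hA : 0 < A) (hC₁ : 0 ≤ C₁)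
    (hLK : IsLocalLeraySolutionOn S₀ 1 a₀ a pK) (hcl : IsClassicalNSSolutionOn (Ioo 0 S₂) 1 0 a π)
    (hbd : ∀ t ∈ Ioo 0 S₂, ∀ x, ‖a t x‖ ≤ 2 * A)
    (hgrad : ∀ t ∈ Ioo 0 S₀, ∀ x, Real.sqrt t * ‖fderiv ℝ (a t) x‖ ≤ C₁ * A)
    {ρ : ℝ} (hρ : 0 < ρ) (ha₀m : AEStronglyMeasurable a₀ volume)
    (hu₀2 : MemLp u₀ 2 volume) (ha₀2 : MemLp a₀ 2 volume)
    (hψ : ContDiff ℝ (⊤ : ℕ∞) ψ) (hψs : tsupport ψ ⊆ ball x₀ ρ) (hψ0 : ∀ x, 0 ≤ ψ x) :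
    ∀ᵐ s ∂(volume.restrict (Ioo 0 (min T' S₀))),
      ENNReal.ofReal (∫ x, ‖u s x - a s x‖ ^ 2 * ψ x) +
          2 * ∫⁻ z in Ioo 0 s ×ˢ (univ : Set (EuclideanSpace ℝ (Fin 3))),
            ENNReal.ofReal (frobeniusNormSq (G z.1 z.2 - fderiv ℝ (a z.1) z.2) * ψ z.2) ≤
        ENNReal.ofReal (∫ x, ‖u₀ x - a₀ x‖ ^ 2 * ψ x) +
        ENNReal.ofReal (∫ z in Ioo 0 s ×ˢ (univ : Set (EuclideanSpace ℝ (Fin 3))),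
          (‖u z.1 z.2 - a z.1 z.2‖ ^ 2 * (Δ ψ) z.2 +
            ‖u z.1 z.2 - a z.1 z.2‖ ^ 2 * ⟪u z.1 z.2, gradient ψ z.2⟫ +
            2 * ((p z.1 z.2 - pK z.1 z.2) * ⟪u z.1 z.2 - a z.1 z.2, gradient ψ z.2⟫) -
            2 * (ψ z.2 * ⟪fderiv ℝ (a z.1) z.2 (u z.1 z.2 - a z.1 z.2), u z.1 z.2 - a z.1 z.2⟫))) := by
  set S : ℝ := min T' S₀ with hSdef
  have hS : 0 < S := lt_min hT' hS₀
  have hST' : S ≤ T' := min_le_left _ _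
  have hSS₀ : S ≤ S₀ := min_le_right _ _
  have hSS₂ : S ≤ S₂ := hSS₀.trans hS₀₂
  -- ## the cut-off `ψ`
  set Kψ : Set (EuclideanSpace ℝ (Fin 3)) := tsupport ψ with hKψ
  have hKc : IsCompact Kψ :=
    (isCompact_closedBall x₀ ρ).of_isClosed_subset (isClosed_tsupport ψ) (hψs.trans Metric.ball_subset_closedBall)
  have hψc : HasCompactSupport ψ := hKc
  have hK2 : Kψ ⊆ ball x₀ (2 * ρ) := hψs.trans (ball_subset_ball (by linarith))
  have hK2' : Kψ ⊆ closedBall x₀ (2 * ρ) := hK2.trans Metric.ball_subset_closedBall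
  have hψK : ∀ x ∉ Kψ, ψ x = 0 := fun x hx => image_eq_zero_of_notMem_tsupport hx
  have hgK : ∀ x ∉ Kψ, gradient ψ x = 0 := fun x hx => by
    have h0 : ψ =ᶠ[𝓝 x] fun _ => (0 : ℝ) := notMem_tsupport_iff_eventuallyEq.1 hx
    rw [gradient, h0.fderiv_eq, fderiv_fun_const, Pi.zero_apply, map_zero]
  have hLK0 : ∀ x ∉ Kψ, (Δ ψ) x = 0 := fun x hx => laplacian_eq_zero_of_notMem_tsupport hx
  have hψcont : Continuous ψ := hψ.continuous
  have hgcont : Continuous fun x => gradient ψ x :=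
    (InnerProductSpace.toDual ℝ (EuclideanSpace ℝ (Fin 3))).symm.continuous.comp (hψ.continuous_fderiv (by simp))
  have hLcont : Continuous fun x => (Δ ψ) x := continuous_laplacian (hψ.of_le (by norm_cast))
  have hgcs : HasCompactSupport fun x => gradient ψ x := by
    refine HasCompactSupport.intro hKc fun x hx => hgK x hx
  have hLcs : HasCompactSupport fun x => (Δ ψ) x := HasCompactSupport.intro hKc fun x hx => hLK0 x hx
  obtain ⟨Cψ, hCψ⟩ := hψcont.bounded_above_of_compact_support hψc
  obtain ⟨Cg, hCg⟩ := hgcont.bounded_above_of_compact_support hgcs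
  obtain ⟨CL, hCL⟩ := hLcont.bounded_above_of_compact_support hLcs
  have hCψ0 : 0 ≤ Cψ := (norm_nonneg _).trans (hCψ x₀)
  have hCg0 : 0 ≤ Cg := (norm_nonneg _).trans (hCg x₀)
  have hCL0 : 0 ≤ CL := (norm_nonneg _).trans (hCL x₀)
  have hψle : ∀ x, ψ x ≤ Cψ := fun x => (Real.le_norm_self _).trans (hCψ x)
  -- ## the box `B = (0,S) × Kψ` and measurability
  set I : Set ℝ := Ioo 0 S with hI
  set B : Set (ℝ × (EuclideanSpace ℝ (Fin 3))) := I ×ˢ Kψ with hB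
  have hBm : MeasurableSet B := measurableSet_Ioo.prod hKc.measurableSet
  have hIT' : I ⊆ Ioo 0 T' := Ioo_subset_Ioo_right hST'
  have hIS₀ : I ⊆ Ioo 0 S₀ := Ioo_subset_Ioo_right hSS₀
  have hIS₂ : I ⊆ Ioo 0 S₂ := Ioo_subset_Ioo_right hSS₂
  have hBT' : B ⊆ Ioo 0 T' ×ˢ ball x₀ (2 * ρ) := Set.prod_mono hIT' hK2
  have hBT'c : B ⊆ Ioo 0 T' ×ˢ closedBall x₀ (2 * ρ) := Set.prod_mono hIT' hK2'
  have hBS₀c : B ⊆ Ioo 0 S₀ ×ˢ closedBall x₀ (2 * ρ) := Set.prod_mono hIS₀ hK2'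
  have hBvol : volume B < ∞ :=
    (measure_mono (Set.prod_mono Ioo_subset_Icc_self Subset.rfl)).trans_lt
      ((isCompact_Icc.prod hKc).measure_lt_top)
  haveI : IsFiniteMeasure (volume.restrict B) := ⟨by rwa [Measure.restrict_apply_univ]⟩
  have hmemB : ∀ᵐ z ∂(volume.restrict B), z ∈ B := ae_restrict_mem hBm
  -- measurability of the fields on the strip `(0,S) × ℝ³` and on `B`
  have hstripm : MeasurableSet (I ×ˢ (univ : Set (EuclideanSpace ℝ (Fin 3)))) := measurableSet_Ioo.prod MeasurableSet.univ
  have hum : AEStronglyMeasurable (uncurry u) (volume.restrict (I ×ˢ (univ : Set (EuclideanSpace ℝ (Fin 3))))) :=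
    hu.aestronglyMeasurable.mono_measure (Measure.restrict_mono (Set.prod_mono hIT' Subset.rfl) le_rfl)
  have hacont : ContinuousOn (uncurry a) (Ioo 0 S₂ ×ˢ (univ : Set (EuclideanSpace ℝ (Fin 3)))) := hcl.smooth_velocity.continuousOn
  have ham : AEStronglyMeasurable (uncurry a) (volume.restrict (I ×ˢ (univ : Set (EuclideanSpace ℝ (Fin 3))))) :=
    (hacont.mono (Set.prod_mono hIS₂ Subset.rfl)).aestronglyMeasurable hstripm
  have hDacont : ContinuousOn (fun z : ℝ × (EuclideanSpace ℝ (Fin 3)) => fderiv ℝ (a z.1) z.2) (Ioo 0 S₂ ×ˢ (univ : Set (EuclideanSpace ℝ (Fin 3)))) :=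
    (hcl.smooth_velocity.fderiv_slice isOpen_Ioo.uniqueDiffOn).continuousOn
  have hDam : AEStronglyMeasurable (fun z : ℝ × (EuclideanSpace ℝ (Fin 3)) => fderiv ℝ (a z.1) z.2) (volume.restrict (I ×ˢ (univ : Set (EuclideanSpace ℝ (Fin 3))))) :=
    (hDacont.mono (Set.prod_mono hIS₂ Subset.rfl)).aestronglyMeasurable hstripm
  have hpm : AEStronglyMeasurable (uncurry p) (volume.restrict (I ×ˢ (univ : Set (EuclideanSpace ℝ (Fin 3))))) :=
    hu.aestronglyMeasurable_pressure.mono_measure (Measure.restrict_mono (Set.prod_mono hIT' Subset.rfl) le_rfl)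
  have hpKm : AEStronglyMeasurable (uncurry pK) (volume.restrict (I ×ˢ (univ : Set (EuclideanSpace ℝ (Fin 3))))) :=
    hLK.aestronglyMeasurable_pressure.mono_measure (Measure.restrict_mono (Set.prod_mono hIS₀ Subset.rfl) le_rfl)
  have hGm : AEStronglyMeasurable (uncurry G) (volume.restrict (I ×ˢ (univ : Set (EuclideanSpace ℝ (Fin 3))))) :=
    hG.locallyIntegrableOn_grad.aestronglyMeasurable.mono_measure
      (Measure.restrict_mono (Set.prod_mono hIT' Subset.rfl) le_rfl)
  have hψm2 : AEStronglyMeasurable (fun z : ℝ × (EuclideanSpace ℝ (Fin 3)) => ψ z.2) (volume.restrict (I ×ˢ (univ : Set (EuclideanSpace ℝ (Fin 3))))) :=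
    (hψcont.comp continuous_snd).aestronglyMeasurable
  have hgm2 : AEStronglyMeasurable (fun z : ℝ × (EuclideanSpace ℝ (Fin 3)) => gradient ψ z.2) (volume.restrict (I ×ˢ (univ : Set (EuclideanSpace ℝ (Fin 3))))) :=
    (hgcont.comp continuous_snd).aestronglyMeasurable
  have hLm2 : AEStronglyMeasurable (fun z : ℝ × (EuclideanSpace ℝ (Fin 3)) => (Δ ψ) z.2) (volume.restrict (I ×ˢ (univ : Set (EuclideanSpace ℝ (Fin 3))))) :=
    (hLcont.comp continuous_snd).aestronglyMeasurable
  have hresB : volume.restrict B ≤ volume.restrict (I ×ˢ (univ : Set (EuclideanSpace ℝ (Fin 3)))) :=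
    Measure.restrict_mono (Set.prod_mono Subset.rfl (subset_univ _)) le_rfl
  -- ## pointwise bounds on `B`
  have hvsq : ∀ z ∈ B, ‖u z.1 z.2 - a z.1 z.2‖ ^ 2 ≤ 2 * ‖u z.1 z.2‖ ^ 2 + 8 * A ^ 2 := by
    intro z hz
    have ha := hbd z.1 (hIS₂ hz.1) z.2
    have h1 : ‖u z.1 z.2 - a z.1 z.2‖ ≤ ‖u z.1 z.2‖ + 2 * A := (norm_sub_le _ _).trans (by linarith)
    have h2 : ‖u z.1 z.2 - a z.1 z.2‖ ^ 2 ≤ (‖u z.1 z.2‖ + 2 * A) ^ 2 := pow_le_pow_left₀ (norm_nonneg _) h1 2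
    nlinarith [h2, sq_nonneg (‖u z.1 z.2‖ - 2 * A)]
  have hvcube : ∀ z ∈ B, ‖u z.1 z.2 - a z.1 z.2‖ ^ 3 ≤ 4 * (‖u z.1 z.2‖ ^ 3 + 8 * A ^ 3) := by
    intro z hz
    have ha := hbd z.1 (hIS₂ hz.1) z.2
    have h1 : ‖u z.1 z.2 - a z.1 z.2‖ ≤ ‖u z.1 z.2‖ + 2 * A := (norm_sub_le _ _).trans (by linarith)
    calc ‖u z.1 z.2 - a z.1 z.2‖ ^ 3 ≤ (‖u z.1 z.2‖ + 2 * A) ^ 3 :=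
          pow_le_pow_left₀ (norm_nonneg _) h1 3
      _ ≤ 4 * (‖u z.1 z.2‖ ^ 3 + (2 * A) ^ 3) := add_pow_three_le_four_mul (norm_nonneg _) (by linarith)
      _ = 4 * (‖u z.1 z.2‖ ^ 3 + 8 * A ^ 3) := by ring
  -- ## integrability of `|u|²`, `|u|³`, `|p|^{3/2}`, `|p_K|^{3/2}` on `B`
  have hu2B : Integrable (fun z : ℝ × (EuclideanSpace ℝ (Fin 3)) => ‖u z.1 z.2‖ ^ 2) (volume.restrict B) := by
    refine ⟨(hum.mono_measure hresB).norm.pow 2, ?_⟩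
    show ∫⁻ z, ‖‖u z.1 z.2‖ ^ 2‖ₑ ∂(volume.restrict B) < ∞
    have e : ∀ z : ℝ × (EuclideanSpace ℝ (Fin 3)), ‖‖u z.1 z.2‖ ^ 2‖ₑ = ‖u z.1 z.2‖ₑ ^ 2 := fun z => by
      rw [Real.enorm_eq_ofReal (sq_nonneg _), ENNReal.ofReal_pow (norm_nonneg _), ofReal_norm]
    simp_rw [e]
    exact (lintegral_mono_set hBT'c).trans_lt (hu.sqIntegrable _ (isCompact_closedBall _ _))
  have hu3B : Integrable (fun z : ℝ × (EuclideanSpace ℝ (Fin 3)) => ‖u z.1 z.2‖ ^ 3) (volume.restrict B) := by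
    refine ⟨(hum.mono_measure hresB).norm.pow 3, ?_⟩
    show ∫⁻ z, ‖‖u z.1 z.2‖ ^ 3‖ₑ ∂(volume.restrict B) < ∞
    have e : ∀ z : ℝ × (EuclideanSpace ℝ (Fin 3)), ‖‖u z.1 z.2‖ ^ 3‖ₑ = ‖u z.1 z.2‖ₑ ^ (3 : ℕ) := fun z => by
      rw [Real.enorm_eq_ofReal (pow_nonneg (norm_nonneg _) _), ENNReal.ofReal_pow (norm_nonneg _), ofReal_norm]
    simp_rw [e]
    exact (lintegral_mono_set hBT').trans_lt (hu.lintegral_cube_box_lt_top x₀ (2 * ρ))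
  have hp32B : Integrable (fun z : ℝ × (EuclideanSpace ℝ (Fin 3)) => |p z.1 z.2| ^ (3 / 2 : ℝ)) (volume.restrict B) := by
    refine ⟨((hpm.mono_measure hresB).norm.aemeasurable.pow_const (3 / 2 : ℝ)).aestronglyMeasurable.congr
      (Eventually.of_forall fun z => by simp only [Real.norm_eq_abs]; rfl), ?_⟩
    show ∫⁻ z, ‖|p z.1 z.2| ^ (3 / 2 : ℝ)‖ₑ ∂(volume.restrict B) < ∞
    have e : ∀ z : ℝ × (EuclideanSpace ℝ (Fin 3)), ‖|p z.1 z.2| ^ (3 / 2 : ℝ)‖ₑ = ‖p z.1 z.2‖ₑ ^ (3 / 2 : ℝ) := fun z => by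
      rw [Real.enorm_eq_ofReal (Real.rpow_nonneg (abs_nonneg _) _), ← Real.norm_eq_abs,
        ← ENNReal.ofReal_rpow_of_nonneg (norm_nonneg _) (by norm_num), ofReal_norm]
    simp_rw [e]
    exact (lintegral_mono_set hBT'c).trans_lt (hu.pressure _ (isCompact_closedBall _ _))
  have hpK32B : Integrable (fun z : ℝ × (EuclideanSpace ℝ (Fin 3)) => |pK z.1 z.2| ^ (3 / 2 : ℝ)) (volume.restrict B) := by
    refine ⟨((hpKm.mono_measure hresB).norm.aemeasurable.pow_const (3 / 2 : ℝ)).aestronglyMeasurable.congr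
      (Eventually.of_forall fun z => by simp only [Real.norm_eq_abs]; rfl), ?_⟩
    show ∫⁻ z, ‖|pK z.1 z.2| ^ (3 / 2 : ℝ)‖ₑ ∂(volume.restrict B) < ∞
    have e : ∀ z : ℝ × (EuclideanSpace ℝ (Fin 3)), ‖|pK z.1 z.2| ^ (3 / 2 : ℝ)‖ₑ = ‖pK z.1 z.2‖ₑ ^ (3 / 2 : ℝ) := fun z => by
      rw [Real.enorm_eq_ofReal (Real.rpow_nonneg (abs_nonneg _) _), ← Real.norm_eq_abs,
        ← ENNReal.ofReal_rpow_of_nonneg (norm_nonneg _) (by norm_num), ofReal_norm]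
    simp_rw [e]
    exact (lintegral_mono_set hBS₀c).trans_lt (hLK.pressure _ (isCompact_closedBall _ _))
  -- ## the energy, dissipation and flux densities
  set W : ℝ × (EuclideanSpace ℝ (Fin 3)) → ℝ := fun z => ‖u z.1 z.2 - a z.1 z.2‖ ^ 2 * ψ z.2 with hW
  set D : ℝ × (EuclideanSpace ℝ (Fin 3)) → ℝ := fun z => frobeniusNormSq (G z.1 z.2 - fderiv ℝ (a z.1) z.2) * ψ z.2 with hD
  set R₁ : ℝ × (EuclideanSpace ℝ (Fin 3)) → ℝ := fun z => ‖u z.1 z.2 - a z.1 z.2‖ ^ 2 * (Δ ψ) z.2 with hR₁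
  set R₂ : ℝ × (EuclideanSpace ℝ (Fin 3)) → ℝ := fun z => ‖u z.1 z.2 - a z.1 z.2‖ ^ 2 * ⟪u z.1 z.2, gradient ψ z.2⟫ with hR₂
  set R₃ : ℝ × (EuclideanSpace ℝ (Fin 3)) → ℝ := fun z => (p z.1 z.2 - pK z.1 z.2) * ⟪u z.1 z.2 - a z.1 z.2, gradient ψ z.2⟫ with hR₃
  set R₄ : ℝ × (EuclideanSpace ℝ (Fin 3)) → ℝ := fun z => ψ z.2 * ⟪fderiv ℝ (a z.1) z.2 (u z.1 z.2 - a z.1 z.2), u z.1 z.2 - a z.1 z.2⟫ with hR₄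
  set R : ℝ × (EuclideanSpace ℝ (Fin 3)) → ℝ := fun z => R₁ z + R₂ z + 2 * R₃ z - 2 * R₄ z with hR
  have hvm : AEStronglyMeasurable (fun z : ℝ × (EuclideanSpace ℝ (Fin 3)) => u z.1 z.2 - a z.1 z.2) (volume.restrict (I ×ˢ (univ : Set (EuclideanSpace ℝ (Fin 3))))) :=
    hum.sub ham
  have hWm : AEStronglyMeasurable W (volume.restrict (I ×ˢ (univ : Set (EuclideanSpace ℝ (Fin 3))))) := (hvm.norm.pow 2).mul hψm2
  have hDm : AEStronglyMeasurable D (volume.restrict (I ×ˢ (univ : Set (EuclideanSpace ℝ (Fin 3))))) := by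
    have hc : Continuous fun L : (EuclideanSpace ℝ (Fin 3)) →L[ℝ] (EuclideanSpace ℝ (Fin 3)) => frobeniusNormSq L := by
      unfold frobeniusNormSq
      exact continuous_finsetSum _ fun i _ => ((ContinuousLinearMap.apply ℝ (EuclideanSpace ℝ (Fin 3)) _).continuous.norm).pow 2
    exact (hc.comp_aestronglyMeasurable (hGm.sub hDam)).mul hψm2
  have hR₁m : AEStronglyMeasurable R₁ (volume.restrict (I ×ˢ (univ : Set (EuclideanSpace ℝ (Fin 3))))) := (hvm.norm.pow 2).mul hLm2
  have hR₂m : AEStronglyMeasurable R₂ (volume.restrict (I ×ˢ (univ : Set (EuclideanSpace ℝ (Fin 3))))) := (hvm.norm.pow 2).mul (hum.inner hgm2)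
  have hR₃m : AEStronglyMeasurable R₃ (volume.restrict (I ×ˢ (univ : Set (EuclideanSpace ℝ (Fin 3))))) := (hpm.sub hpKm).mul (hvm.inner hgm2)
  have happ : AEStronglyMeasurable (fun z : ℝ × (EuclideanSpace ℝ (Fin 3)) => fderiv ℝ (a z.1) z.2 (u z.1 z.2 - a z.1 z.2))
      (volume.restrict (I ×ˢ (univ : Set (EuclideanSpace ℝ (Fin 3))))) :=
    isBoundedBilinearMap_apply.continuous.comp_aestronglyMeasurable (hDam.prodMk hvm)
  have hR₄m : AEStronglyMeasurable R₄ (volume.restrict (I ×ˢ (univ : Set (EuclideanSpace ℝ (Fin 3))))) :=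
    hψm2.mul (happ.inner hvm)
  -- ## integrability of `W`, `R₁`, `R₂`, `R₃` on `B`
  have hgW : Integrable (fun z : ℝ × (EuclideanSpace ℝ (Fin 3)) => Cψ * (2 * ‖u z.1 z.2‖ ^ 2 + 8 * A ^ 2)) (volume.restrict B) :=
    ((hu2B.const_mul 2).add (integrable_const _)).const_mul Cψ
  have hW0z : ∀ z, 0 ≤ W z := fun z => mul_nonneg (sq_nonneg _) (hψ0 _)
  have hWB : Integrable W (volume.restrict B) := by
    refine Integrable.mono' hgW (hWm.mono_measure hresB) ?_
    filter_upwards [hmemB] with z hz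
    rw [Real.norm_eq_abs, abs_of_nonneg (hW0z z)]
    calc W z = ‖u z.1 z.2 - a z.1 z.2‖ ^ 2 * ψ z.2 := rfl
      _ ≤ (2 * ‖u z.1 z.2‖ ^ 2 + 8 * A ^ 2) * Cψ := mul_le_mul (hvsq z hz) (hψle _) (hψ0 _) (by positivity)
      _ = Cψ * (2 * ‖u z.1 z.2‖ ^ 2 + 8 * A ^ 2) := mul_comm _ _
  have hR₁B : Integrable R₁ (volume.restrict B) := by
    have hg : Integrable (fun z : ℝ × (EuclideanSpace ℝ (Fin 3)) => CL * (2 * ‖u z.1 z.2‖ ^ 2 + 8 * A ^ 2)) (volume.restrict B) :=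
      ((hu2B.const_mul 2).add (integrable_const _)).const_mul CL
    refine Integrable.mono' hg (hR₁m.mono_measure hresB) ?_
    filter_upwards [hmemB] with z hz
    rw [hR₁, norm_mul, Real.norm_eq_abs, abs_of_nonneg (sq_nonneg _)]
    calc ‖u z.1 z.2 - a z.1 z.2‖ ^ 2 * ‖(Δ ψ) z.2‖ ≤ (2 * ‖u z.1 z.2‖ ^ 2 + 8 * A ^ 2) * CL :=
          mul_le_mul (hvsq z hz) (hCL _) (norm_nonneg _) (by positivity)
      _ = CL * (2 * ‖u z.1 z.2‖ ^ 2 + 8 * A ^ 2) := mul_comm _ _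
  have hnorm_le_cube : ∀ r : ℝ, 0 ≤ r → r ≤ 1 + r ^ 3 := fun r hr => by nlinarith [sq_nonneg (r - 1), sq_nonneg r]
  have hR₂B : Integrable R₂ (volume.restrict B) := by
    have hg : Integrable (fun z : ℝ × (EuclideanSpace ℝ (Fin 3)) => Cg * (2 * ‖u z.1 z.2‖ ^ 3 + 8 * A ^ 2 * (1 + ‖u z.1 z.2‖ ^ 3)))
        (volume.restrict B) :=
      ((hu3B.const_mul 2).add (((integrable_const (1 : ℝ)).add hu3B).const_mul _)).const_mul Cg
    refine Integrable.mono' hg (hR₂m.mono_measure hresB) ?_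
    filter_upwards [hmemB] with z hz
    rw [hR₂, norm_mul, Real.norm_eq_abs, abs_of_nonneg (sq_nonneg _)]
    have h1 : ‖⟪u z.1 z.2, gradient ψ z.2⟫‖ ≤ ‖u z.1 z.2‖ * Cg :=
      (norm_inner_le_norm _ _).trans (mul_le_mul_of_nonneg_left (hCg _) (norm_nonneg _))
    have hu0 := norm_nonneg (u z.1 z.2)
    calc ‖u z.1 z.2 - a z.1 z.2‖ ^ 2 * ‖⟪u z.1 z.2, gradient ψ z.2⟫‖
        ≤ (2 * ‖u z.1 z.2‖ ^ 2 + 8 * A ^ 2) * (‖u z.1 z.2‖ * Cg) :=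
          mul_le_mul (hvsq z hz) h1 (norm_nonneg _) (by positivity)
      _ = Cg * (2 * ‖u z.1 z.2‖ ^ 3 + 8 * A ^ 2 * ‖u z.1 z.2‖) := by ring
      _ ≤ Cg * (2 * ‖u z.1 z.2‖ ^ 3 + 8 * A ^ 2 * (1 + ‖u z.1 z.2‖ ^ 3)) := by
          gcongr
          exact hnorm_le_cube _ hu0
  have hR₃B : Integrable R₃ (volume.restrict B) := by
    have hg : Integrable (fun z : ℝ × (EuclideanSpace ℝ (Fin 3)) => Cg * ((2 / 3) * (|p z.1 z.2| ^ (3 / 2 : ℝ) + |pK z.1 z.2| ^ (3 / 2 : ℝ)) +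
        (2 / 3) * (4 * (‖u z.1 z.2‖ ^ 3 + 8 * A ^ 3)))) (volume.restrict B) :=
      (((hp32B.add hpK32B).const_mul _).add (((hu3B.add (integrable_const _)).const_mul 4).const_mul _)).const_mul Cg
    refine Integrable.mono' hg (hR₃m.mono_measure hresB) ?_
    filter_upwards [hmemB] with z hz
    rw [hR₃, norm_mul, Real.norm_eq_abs]
    have h1 : ‖⟪u z.1 z.2 - a z.1 z.2, gradient ψ z.2⟫‖ ≤ ‖u z.1 z.2 - a z.1 z.2‖ * Cg :=
      (norm_inner_le_norm _ _).trans (mul_le_mul_of_nonneg_left (hCg _) (norm_nonneg _))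
    have hv0 := norm_nonneg (u z.1 z.2 - a z.1 z.2)
    have hY₁ := mul_le_rpow_threeHalves_add_cube (|p z.1 z.2|) hv0
    have hY₂ := mul_le_rpow_threeHalves_add_cube (|pK z.1 z.2|) hv0
    rw [abs_abs] at hY₁ hY₂
    have hc3 := hvcube z hz
    calc |p z.1 z.2 - pK z.1 z.2| * ‖⟪u z.1 z.2 - a z.1 z.2, gradient ψ z.2⟫‖
        ≤ (|p z.1 z.2| + |pK z.1 z.2|) * (‖u z.1 z.2 - a z.1 z.2‖ * Cg) :=
          mul_le_mul (abs_sub _ _) h1 (norm_nonneg _) (by positivity)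
      _ = Cg * (|p z.1 z.2| * ‖u z.1 z.2 - a z.1 z.2‖ + |pK z.1 z.2| * ‖u z.1 z.2 - a z.1 z.2‖) := by ring
      _ ≤ Cg * ((2 / 3) * (|p z.1 z.2| ^ (3 / 2 : ℝ) + |pK z.1 z.2| ^ (3 / 2 : ℝ)) +
            (2 / 3) * (4 * (‖u z.1 z.2‖ ^ 3 + 8 * A ^ 3))) := by
          refine mul_le_mul_of_nonneg_left ?_ hCg0
          nlinarith [hY₁, hY₂, hc3]
  -- ## integrability of `R₄` on `B`: the parabolic gradient bound and the uniform local energy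
  have hDa_le : ∀ z ∈ B, ‖fderiv ℝ (a z.1) z.2‖ ≤ C₁ * A * z.1 ^ (-(1 / 2 : ℝ)) := by
    intro z hz
    have ht : 0 < z.1 := hz.1.1
    have h := hgrad z.1 (hIS₀ hz.1) z.2
    have hs : 0 < Real.sqrt z.1 := Real.sqrt_pos.2 ht
    rw [Real.rpow_neg ht.le, ← Real.sqrt_eq_rpow, ← div_eq_mul_inv, le_div_iff₀ hs, mul_comm]
    exact h
  obtain ⟨Cen, hCen⟩ := hu.uniformLocalEnergy (2 * ρ) (by positivity)
  have hCenI : ∀ᵐ t ∂(volume.restrict I), ∫⁻ x in Kψ, ‖u t x‖ₑ ^ 2 ≤ Cen := by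
    filter_upwards [ae_restrict_of_ae_restrict_of_subset hIT' hCen] with t ht
    exact (lintegral_mono_set hK2).trans (ht x₀)
  have hrpowI : IntegrableOn (fun t : ℝ => t ^ (-(1 / 2 : ℝ))) I volume :=
    (intervalIntegral.integrableOn_Ioo_rpow_iff hS).2 (by norm_num)
  have hprodB : volume.restrict B = (volume.restrict I).prod (volume.restrict Kψ) := by
    rw [hB, Measure.prod_restrict, ← Measure.volume_eq_prod]
  have hKvol : volume Kψ < ∞ := hKc.measure_lt_top
  haveI : IsFiniteMeasure (volume.restrict Kψ) := ⟨by rwa [Measure.restrict_apply_univ]⟩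
  have hg₄₁ : Integrable (fun z : ℝ × (EuclideanSpace ℝ (Fin 3)) => z.1 ^ (-(1 / 2 : ℝ)) * (8 * A ^ 2)) (volume.restrict B) := by
    rw [hprodB]
    exact hrpowI.mul_prod (integrable_const (8 * A ^ 2))
  have hg₄₂ : Integrable (fun z : ℝ × (EuclideanSpace ℝ (Fin 3)) => z.1 ^ (-(1 / 2 : ℝ)) * ‖u z.1 z.2‖ ^ 2) (volume.restrict B) := by
    have hm : AEStronglyMeasurable (fun z : ℝ × (EuclideanSpace ℝ (Fin 3)) => z.1 ^ (-(1 / 2 : ℝ)) * ‖u z.1 z.2‖ ^ 2) (volume.restrict B) :=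
      ((measurable_fst.pow_const _).aestronglyMeasurable).mul ((hum.mono_measure hresB).norm.pow 2)
    refine ⟨hm, ?_⟩
    show ∫⁻ z, ‖z.1 ^ (-(1 / 2 : ℝ)) * ‖u z.1 z.2‖ ^ 2‖ₑ ∂(volume.restrict B) < ∞
    have e : ∀ z : ℝ × (EuclideanSpace ℝ (Fin 3)), z ∈ B → ‖z.1 ^ (-(1 / 2 : ℝ)) * ‖u z.1 z.2‖ ^ 2‖ₑ =
        ENNReal.ofReal (z.1 ^ (-(1 / 2 : ℝ))) * ‖u z.1 z.2‖ₑ ^ 2 := by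
      intro z hz
      rw [enorm_mul, Real.enorm_eq_ofReal (Real.rpow_nonneg hz.1.1.le _), Real.enorm_eq_ofReal (sq_nonneg _),
        ENNReal.ofReal_pow (norm_nonneg _), ofReal_norm]
    rw [lintegral_congr_ae (hmemB.mono fun z hz => e z hz), hprodB]
    have hFm : AEMeasurable (fun z : ℝ × (EuclideanSpace ℝ (Fin 3)) => ENNReal.ofReal (z.1 ^ (-(1 / 2 : ℝ))) * ‖u z.1 z.2‖ₑ ^ 2)
        ((volume.restrict I).prod (volume.restrict Kψ)) := by
      rw [← hprodB]
      exact (measurable_fst.pow_const _).ennreal_ofReal.aemeasurable.mul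
        ((hum.mono_measure hresB).aemeasurable.enorm.pow_const _)
    rw [lintegral_prod _ hFm]
    have hslice : ∀ᵐ t ∂(volume.restrict I),
        ∫⁻ x, ENNReal.ofReal (t ^ (-(1 / 2 : ℝ))) * ‖u t x‖ₑ ^ 2 ∂(volume.restrict Kψ) ≤
          ENNReal.ofReal (t ^ (-(1 / 2 : ℝ))) * Cen := by
      filter_upwards [hCenI] with t ht
      rw [lintegral_const_mul' _ _ ENNReal.ofReal_ne_top]
      gcongr
    calc ∫⁻ t, ∫⁻ x, ENNReal.ofReal (t ^ (-(1 / 2 : ℝ))) * ‖u t x‖ₑ ^ 2 ∂(volume.restrict Kψ) ∂(volume.restrict I)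
        ≤ ∫⁻ t, ENNReal.ofReal (t ^ (-(1 / 2 : ℝ))) * Cen ∂(volume.restrict I) := lintegral_mono_ae hslice
      _ = (∫⁻ t, ENNReal.ofReal (t ^ (-(1 / 2 : ℝ))) ∂(volume.restrict I)) * Cen :=
          lintegral_mul_const _ (measurable_id.pow_const _).ennreal_ofReal
      _ < ∞ := by
          refine ENNReal.mul_lt_top ?_ ENNReal.coe_lt_top
          have h := hrpowI.2
          simp only [HasFiniteIntegral] at h
          refine lt_of_le_of_lt (lintegral_mono_ae ?_) h
          filter_upwards [ae_restrict_mem measurableSet_Ioo] with t ht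
          rw [Real.enorm_eq_ofReal (Real.rpow_nonneg ht.1.le _)]
  have hR₄B : Integrable R₄ (volume.restrict B) := by
    have hg : Integrable (fun z : ℝ × (EuclideanSpace ℝ (Fin 3)) => Cψ * (C₁ * A) * (2 * (z.1 ^ (-(1 / 2 : ℝ)) * ‖u z.1 z.2‖ ^ 2) +
        z.1 ^ (-(1 / 2 : ℝ)) * (8 * A ^ 2))) (volume.restrict B) :=
      ((hg₄₂.const_mul 2).add hg₄₁).const_mul _
    refine Integrable.mono' hg (hR₄m.mono_measure hresB) ?_
    filter_upwards [hmemB] with z hz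
    rw [hR₄, norm_mul, Real.norm_eq_abs, abs_of_nonneg (hψ0 _)]
    have ht0 : 0 ≤ z.1 ^ (-(1 / 2 : ℝ)) := Real.rpow_nonneg hz.1.1.le _
    have h1 : ‖⟪fderiv ℝ (a z.1) z.2 (u z.1 z.2 - a z.1 z.2), u z.1 z.2 - a z.1 z.2⟫‖ ≤
        C₁ * A * z.1 ^ (-(1 / 2 : ℝ)) * ‖u z.1 z.2 - a z.1 z.2‖ ^ 2 := by
      refine (norm_inner_le_norm _ _).trans ?_
      rw [pow_two, ← mul_assoc]
      refine mul_le_mul_of_nonneg_right ((ContinuousLinearMap.le_opNorm _ _).trans ?_) (norm_nonneg _)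
      exact mul_le_mul_of_nonneg_right (hDa_le z hz) (norm_nonneg _)
    calc ψ z.2 * ‖⟪fderiv ℝ (a z.1) z.2 (u z.1 z.2 - a z.1 z.2), u z.1 z.2 - a z.1 z.2⟫‖
        ≤ Cψ * (C₁ * A * z.1 ^ (-(1 / 2 : ℝ)) * (2 * ‖u z.1 z.2‖ ^ 2 + 8 * A ^ 2)) := by
          refine mul_le_mul (hψle _) (h1.trans ?_) (norm_nonneg _) hCψ0
          exact mul_le_mul_of_nonneg_left (hvsq z hz) (by positivity)
      _ = Cψ * (C₁ * A) * (2 * (z.1 ^ (-(1 / 2 : ℝ)) * ‖u z.1 z.2‖ ^ 2) + z.1 ^ (-(1 / 2 : ℝ)) * (8 * A ^ 2)) := by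
          ring
  -- ## from the box to the strip
  have hW0K : ∀ z : ℝ × (EuclideanSpace ℝ (Fin 3)), z.2 ∉ Kψ → W z = 0 := fun z hz => by simp only [hW, hψK _ hz, mul_zero]
  have hR0K : ∀ z : ℝ × (EuclideanSpace ℝ (Fin 3)), z.2 ∉ Kψ → R z = 0 := fun z hz => by
    simp only [hR, hR₁, hR₂, hR₃, hR₄, hψK _ hz, hgK _ hz, hLK0 _ hz, inner_zero_right, mul_zero, zero_mul,
      add_zero, sub_zero]
  have hWI : IntegrableOn W (I ×ˢ (univ : Set (EuclideanSpace ℝ (Fin 3)))) volume :=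
    integrableOn_strip_of_box hWB hW0K measurableSet_Ioo hKc.measurableSet
  have hRB : Integrable R (volume.restrict B) := ((hR₁B.add hR₂B).add (hR₃B.const_mul 2)).sub (hR₄B.const_mul 2)
  have hRI : IntegrableOn R (I ×ˢ (univ : Set (EuclideanSpace ℝ (Fin 3)))) volume :=
    integrableOn_strip_of_box hRB hR0K measurableSet_Ioo hKc.measurableSet
  -- ## the dissipation on `[a', b'] × ℝ³`
  have hDint : ∀ a' b' : ℝ, 0 < a' → b' < S → IntegrableOn D (Icc a' b' ×ˢ (univ : Set (EuclideanSpace ℝ (Fin 3)))) volume := by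
    intro a' b' ha' hb'
    have hD0K : ∀ z : ℝ × (EuclideanSpace ℝ (Fin 3)), z.2 ∉ Kψ → D z = 0 := fun z hz => by simp only [hD, hψK _ hz, mul_zero]
    refine integrableOn_strip_of_box ?_ hD0K measurableSet_Icc hKc.measurableSet
    rcases le_or_gt a' b' with hab | hab
    swap
    · rw [Icc_eq_empty (not_le.2 hab), empty_prod]; exact integrableOn_empty
    set B' : Set (ℝ × (EuclideanSpace ℝ (Fin 3))) := Icc a' b' ×ˢ Kψ with hB'
    have hB'B : B' ⊆ B := Set.prod_mono (fun t ht => ⟨ha'.trans_le ht.1, ht.2.trans_lt hb'⟩) Subset.rfl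
    have hB'm : MeasurableSet B' := measurableSet_Icc.prod hKc.measurableSet
    have hresB' : volume.restrict B' ≤ volume.restrict (I ×ˢ (univ : Set (EuclideanSpace ℝ (Fin 3)))) :=
      (Measure.restrict_mono hB'B le_rfl).trans hresB
    haveI : IsFiniteMeasure (volume.restrict B') :=
      ⟨by rw [Measure.restrict_apply_univ]; exact (measure_mono hB'B).trans_lt hBvol⟩
    -- `|G|²` is integrable on `B'`
    obtain ⟨CG, hCG⟩ := hGb (2 * ρ) (by positivity)
    have hfG : Integrable (fun z : ℝ × (EuclideanSpace ℝ (Fin 3)) => frobeniusNormSq (G z.1 z.2)) (volume.restrict B') := by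
      have hc : Continuous fun L : (EuclideanSpace ℝ (Fin 3)) →L[ℝ] (EuclideanSpace ℝ (Fin 3)) => frobeniusNormSq L := by
        unfold frobeniusNormSq
        exact continuous_finsetSum _ fun i _ => ((ContinuousLinearMap.apply ℝ (EuclideanSpace ℝ (Fin 3)) _).continuous.norm).pow 2
      refine ⟨hc.comp_aestronglyMeasurable (hGm.mono_measure hresB'), ?_⟩
      show ∫⁻ z, ‖frobeniusNormSq (G z.1 z.2)‖ₑ ∂(volume.restrict B') < ∞
      have e : ∀ z : ℝ × (EuclideanSpace ℝ (Fin 3)), ‖frobeniusNormSq (G z.1 z.2)‖ₑ = ENNReal.ofReal (frobeniusNormSq (G z.1 z.2)) := fun z =>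
        Real.enorm_eq_ofReal (frobeniusNormSq_nonneg _)
      simp_rw [e]
      exact (lintegral_mono_set (hB'B.trans hBT')).trans_lt ((hCG x₀).trans_lt ENNReal.coe_lt_top)
    have hg : Integrable (fun z : ℝ × (EuclideanSpace ℝ (Fin 3)) => Cψ * (2 * frobeniusNormSq (G z.1 z.2) + 6 * ((C₁ * A) ^ 2 / a')))
        (volume.restrict B') := ((hfG.const_mul 2).add (integrable_const _)).const_mul Cψ
    refine Integrable.mono' hg (hDm.mono_measure hresB') ?_
    filter_upwards [ae_restrict_mem hB'm] with z hz
    have hzB : z ∈ B := hB'B hz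
    have ht : a' ≤ z.1 := hz.1.1
    have ht0 : 0 < z.1 := ha'.trans_le ht
    rw [hD, norm_mul, Real.norm_eq_abs, abs_of_nonneg (frobeniusNormSq_nonneg _), Real.norm_eq_abs,
      abs_of_nonneg (hψ0 _), mul_comm]
    refine mul_le_mul (hψle _) ?_ (frobeniusNormSq_nonneg _) hCψ0
    refine (frobeniusNormSq_sub_le _ _).trans ?_
    have hDa2 : frobeniusNormSq (fderiv ℝ (a z.1) z.2) ≤ 3 * ((C₁ * A) ^ 2 / a') := by
      refine (frobeniusNormSq_le_three_mul _).trans (mul_le_mul_of_nonneg_left ?_ (by norm_num))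
      have h1 := hDa_le z hzB
      have h2 : z.1 ^ (-(1 / 2 : ℝ)) ≤ a' ^ (-(1 / 2 : ℝ)) :=
        Real.rpow_le_rpow_of_nonpos ha' ht (by norm_num)
      have h3 : ‖fderiv ℝ (a z.1) z.2‖ ≤ C₁ * A * a' ^ (-(1 / 2 : ℝ)) :=
        h1.trans (mul_le_mul_of_nonneg_left h2 (by positivity))
      have h4 : (a' ^ (-(1 / 2 : ℝ))) ^ 2 = 1 / a' := by
        rw [← Real.rpow_natCast, ← Real.rpow_mul ha'.le]
        norm_num
        rw [Real.rpow_neg_one]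
      calc ‖fderiv ℝ (a z.1) z.2‖ ^ 2 ≤ (C₁ * A * a' ^ (-(1 / 2 : ℝ))) ^ 2 :=
            pow_le_pow_left₀ (norm_nonneg _) h3 2
        _ = (C₁ * A) ^ 2 / a' := by rw [mul_pow, h4]; ring
    linarith
  -- ## the initial condition: `∫ |v(t)|²ψ → ∫ |u₀ - a₀|²ψ`
  set L : ℝ := ∫ x, ‖u₀ x - a₀ x‖ ^ 2 * ψ x with hLdef
  have hL0 : 0 ≤ L := integral_nonneg fun x => mul_nonneg (sq_nonneg _) (hψ0 x)
  -- the initial density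
  set W₀ : EuclideanSpace ℝ (Fin 3) → ℝ := fun x => ‖u₀ x - a₀ x‖ ^ 2 * ψ x with hW₀
  have hW₀0 : ∀ x, 0 ≤ W₀ x := fun x => mul_nonneg (sq_nonneg _) (hψ0 x)
  have hw₀2 : MemLp (fun x => u₀ x - a₀ x) 2 volume := hu₀2.sub ha₀2
  have hW₀m : AEStronglyMeasurable W₀ volume := ((hm₀.sub ha₀m).norm.pow 2).mul hψcont.aestronglyMeasurable
  have hW₀int : Integrable W₀ volume := by
    have h1 : Integrable (fun x => ‖u₀ x - a₀ x‖ ^ 2) volume := (memLp_two_iff_integrable_sq_norm hw₀2.1).1 hw₀2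
    refine (h1.mul_const Cψ).mono' hW₀m (Eventually.of_forall fun x => ?_)
    rw [Real.norm_eq_abs, abs_of_nonneg (hW₀0 x)]
    exact mul_le_mul_of_nonneg_left (hψle x) (sq_nonneg _)
  set Λ₀ : ℝ≥0∞ := ∫⁻ x, ENNReal.ofReal (W₀ x) with hΛ₀
  have hΛ₀L : Λ₀ = ENNReal.ofReal L := by
    rw [hΛ₀, hLdef, ofReal_integral_eq_lintegral_ofReal hW₀int (Eventually.of_forall hW₀0)]
  have hΛ₀t : Λ₀ ≠ ⊤ := by rw [hΛ₀L]; exact ENNReal.ofReal_ne_top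
  have hlim : ∀ ε > 0, ∃ τ > 0, ∀ᵐ t ∂(volume.restrict (Ioo 0 τ)), |(∫ x, W (t, x)) - L| ≤ ε := by
    intro ε hε
    have hCψ1 : 0 < Cψ + 1 := by linarith
    -- `η L ≤ ε / 2`
    set η : ℝ := ε / (2 * (L + 1)) with hηdef
    have hη : 0 < η := by positivity
    have hηL : η * L ≤ ε / 2 := by
      rw [hηdef]
      have hL1 : L / (L + 1) ≤ 1 := (div_le_one (by linarith)).2 (by linarith)
      calc ε / (2 * (L + 1)) * L = ε / 2 * (L / (L + 1)) := by field_simp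
        _ ≤ ε / 2 * 1 := by gcongr
        _ = ε / 2 := mul_one _
    set cη : ℝ := 1 + 1 / η with hcηdef
    have hcη : 0 < cη := by positivity
    -- the increment is small on `Kψ`
    set δr : ℝ := ε / (2 * cη * (4 * (Cψ + 1))) with hδr
    have hδr0 : 0 < δr := by positivity
    set δ : ℝ≥0∞ := ENNReal.ofReal δr with hδ
    have hδpos : 0 < δ := ENNReal.ofReal_pos.2 hδr0
    have h1 := hu.initial Kψ hKc
    have h2 := hLK.initial Kψ hKc
    have e1 : ∀ᶠ t in 𝓝[>] (0 : ℝ), ∫⁻ x in Kψ, ‖u t x - u₀ x‖ₑ ^ 2 < δ := h1 (Iio_mem_nhds hδpos)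
    have e2 : ∀ᶠ t in 𝓝[>] (0 : ℝ), ∫⁻ x in Kψ, ‖a t x - a₀ x‖ₑ ^ 2 < δ := h2 (Iio_mem_nhds hδpos)
    obtain ⟨τ₀, hτ₀, hτsub⟩ := (mem_nhdsGT_iff_exists_Ioo_subset).1 (e1.and e2)
    set τ : ℝ := min τ₀ S with hτ
    have hτpos : 0 < τ := lt_min hτ₀ hS
    refine ⟨τ, hτpos, ?_⟩
    have hslice := ae_restrict_of_ae_restrict_of_subset (Ioo_subset_Ioo_right ((min_le_right τ₀ S).trans hST'))
      hu.ae_aestronglyMeasurable_slice'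
    filter_upwards [ae_restrict_mem measurableSet_Ioo, hslice] with t ht hut
    obtain ⟨ht1, ht2⟩ := hτsub ⟨ht.1, ht.2.trans_le (min_le_left _ _)⟩
    have htS₂ : t ∈ Ioo 0 S₂ := ⟨ht.1, (ht.2.trans_le (min_le_right _ _)).trans_le hSS₂⟩
    -- the slice `a t` is continuous, hence measurable
    have hat : AEStronglyMeasurable (a t) volume := by
      have hinc : Continuous fun x : EuclideanSpace ℝ (Fin 3) => ((t, x) : ℝ × EuclideanSpace ℝ (Fin 3)) :=
        continuous_const.prodMk continuous_id
      exact (hacont.comp_continuous hinc fun x => ⟨htS₂, mem_univ x⟩).aestronglyMeasurable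
    -- the fields `f = u(t) - a(t)`, `g = u₀ - a₀` and the increment `F = f - g`
    have hFm : AEStronglyMeasurable (fun x => (u t x - a t x) - (u₀ x - a₀ x)) volume :=
      (hut.sub hat).sub (hm₀.sub ha₀m)
    set J : ℝ≥0∞ := ∫⁻ x, ‖(u t x - a t x) - (u₀ x - a₀ x)‖ₑ ^ 2 * ENNReal.ofReal (ψ x) with hJ
    -- `J ≤ 2Cψ (δ + δ)`
    have hmeas1 : AEMeasurable (Kψ.indicator fun x => ‖u t x - u₀ x‖ₑ ^ 2) volume :=
      ((hut.sub hm₀).aemeasurable.enorm.pow_const _).indicator hKc.measurableSet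
    have hJle : J ≤ ENNReal.ofReal (2 * Cψ) * (δ + δ) := by
      have hpt : ∀ x, ‖(u t x - a t x) - (u₀ x - a₀ x)‖ₑ ^ 2 * ENNReal.ofReal (ψ x) ≤ ENNReal.ofReal (2 * Cψ) *
          (Kψ.indicator (fun x => ‖u t x - u₀ x‖ₑ ^ 2) x + Kψ.indicator (fun x => ‖a t x - a₀ x‖ₑ ^ 2) x) := by
        intro x
        by_cases hx : x ∈ Kψ
        · rw [indicator_of_mem hx, indicator_of_mem hx]
          have hdec : (u t x - a t x) - (u₀ x - a₀ x) = (u t x - u₀ x) - (a t x - a₀ x) := by abel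
          have hn : ‖(u t x - a t x) - (u₀ x - a₀ x)‖ ^ 2 ≤ 2 * ‖u t x - u₀ x‖ ^ 2 + 2 * ‖a t x - a₀ x‖ ^ 2 := by
            rw [hdec]
            have hsl := pow_le_pow_left₀ (norm_nonneg _) (norm_sub_le (u t x - u₀ x) (a t x - a₀ x)) 2
            nlinarith [hsl, sq_nonneg (‖u t x - u₀ x‖ - ‖a t x - a₀ x‖)]
          have hreal : ‖(u t x - a t x) - (u₀ x - a₀ x)‖ ^ 2 * ψ x ≤
              2 * Cψ * (‖u t x - u₀ x‖ ^ 2 + ‖a t x - a₀ x‖ ^ 2) := by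
            calc ‖(u t x - a t x) - (u₀ x - a₀ x)‖ ^ 2 * ψ x
                ≤ (2 * ‖u t x - u₀ x‖ ^ 2 + 2 * ‖a t x - a₀ x‖ ^ 2) * Cψ :=
                  mul_le_mul hn (hψle x) (hψ0 x) (by positivity)
              _ = 2 * Cψ * (‖u t x - u₀ x‖ ^ 2 + ‖a t x - a₀ x‖ ^ 2) := by ring
          calc ‖(u t x - a t x) - (u₀ x - a₀ x)‖ₑ ^ 2 * ENNReal.ofReal (ψ x)
              = ENNReal.ofReal (‖(u t x - a t x) - (u₀ x - a₀ x)‖ ^ 2 * ψ x) := by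
                rw [ENNReal.ofReal_mul (sq_nonneg _), ← ofReal_norm, ENNReal.ofReal_pow (norm_nonneg _)]
            _ ≤ ENNReal.ofReal (2 * Cψ * (‖u t x - u₀ x‖ ^ 2 + ‖a t x - a₀ x‖ ^ 2)) := ENNReal.ofReal_le_ofReal hreal
            _ = ENNReal.ofReal (2 * Cψ) * (‖u t x - u₀ x‖ₑ ^ 2 + ‖a t x - a₀ x‖ₑ ^ 2) := by
                rw [ENNReal.ofReal_mul (by positivity), ENNReal.ofReal_add (sq_nonneg _) (sq_nonneg _),
                  ← ofReal_norm, ← ofReal_norm, ← ENNReal.ofReal_pow (norm_nonneg _),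
                  ← ENNReal.ofReal_pow (norm_nonneg _)]
        · have hψx : ψ x = 0 := hψK x hx
          rw [hψx, ENNReal.ofReal_zero, mul_zero]
          exact bot_le
      calc J ≤ ∫⁻ x, ENNReal.ofReal (2 * Cψ) *
            (Kψ.indicator (fun x => ‖u t x - u₀ x‖ₑ ^ 2) x + Kψ.indicator (fun x => ‖a t x - a₀ x‖ₑ ^ 2) x) :=
            lintegral_mono hpt
        _ = ENNReal.ofReal (2 * Cψ) * ((∫⁻ x in Kψ, ‖u t x - u₀ x‖ₑ ^ 2) + ∫⁻ x in Kψ, ‖a t x - a₀ x‖ₑ ^ 2) := by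
            rw [lintegral_const_mul' _ _ ENNReal.ofReal_ne_top, lintegral_add_left' hmeas1,
              lintegral_indicator hKc.measurableSet, lintegral_indicator hKc.measurableSet]
        _ ≤ ENNReal.ofReal (2 * Cψ) * (δ + δ) := by gcongr
    have hJt : J ≠ ⊤ := by
      refine ne_top_of_le_ne_top ?_ hJle
      exact ENNReal.mul_ne_top ENNReal.ofReal_ne_top (ENNReal.add_ne_top.2 ⟨ENNReal.ofReal_ne_top, ENNReal.ofReal_ne_top⟩)
    -- the two-sided comparison of `Λ(t) = ∫ W(t)` with `Λ₀`
    set Λ : ℝ≥0∞ := ∫⁻ x, ENNReal.ofReal (W (t, x)) with hΛ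
    set E : ℝ≥0∞ := ENNReal.ofReal cη * J + ENNReal.ofReal η * Λ₀ with hE
    have hEt : E ≠ ⊤ := ENNReal.add_ne_top.2 ⟨ENNReal.mul_ne_top ENNReal.ofReal_ne_top hJt,
      ENNReal.mul_ne_top ENNReal.ofReal_ne_top hΛ₀t⟩
    -- pointwise: `‖f‖² ≤ ‖g‖² + cη‖f - g‖² + η‖g‖²` and the symmetric inequality
    have hkey : ∀ x, |‖u t x - a t x‖ ^ 2 - ‖u₀ x - a₀ x‖ ^ 2| ≤
        cη * ‖(u t x - a t x) - (u₀ x - a₀ x)‖ ^ 2 + η * ‖u₀ x - a₀ x‖ ^ 2 := fun x =>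
      abs_norm_sq_sub_norm_sq_le_eta _ _ hη
    have hmid : ∀ x, ENNReal.ofReal (cη * (‖(u t x - a t x) - (u₀ x - a₀ x)‖ ^ 2 * ψ x)) =
        ENNReal.ofReal cη * (‖(u t x - a t x) - (u₀ x - a₀ x)‖ₑ ^ 2 * ENNReal.ofReal (ψ x)) := fun x => by
      rw [ENNReal.ofReal_mul hcη.le, ENNReal.ofReal_mul (sq_nonneg _), ← ofReal_norm, ENNReal.ofReal_pow (norm_nonneg _)]
    have hpt1 : ∀ x, ENNReal.ofReal (W (t, x)) ≤ ENNReal.ofReal (W₀ x) +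
        (ENNReal.ofReal cη * (‖(u t x - a t x) - (u₀ x - a₀ x)‖ₑ ^ 2 * ENNReal.ofReal (ψ x)) +
          ENNReal.ofReal η * ENNReal.ofReal (W₀ x)) := by
      intro x
      have h := (abs_le.1 (hkey x)).2
      have hreal : W (t, x) ≤ W₀ x + (cη * (‖(u t x - a t x) - (u₀ x - a₀ x)‖ ^ 2 * ψ x) + η * W₀ x) := by
        show ‖u t x - a t x‖ ^ 2 * ψ x ≤ ‖u₀ x - a₀ x‖ ^ 2 * ψ x +
          (cη * (‖(u t x - a t x) - (u₀ x - a₀ x)‖ ^ 2 * ψ x) + η * (‖u₀ x - a₀ x‖ ^ 2 * ψ x))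
        have := mul_le_mul_of_nonneg_right (show ‖u t x - a t x‖ ^ 2 ≤ ‖u₀ x - a₀ x‖ ^ 2 +
          (cη * ‖(u t x - a t x) - (u₀ x - a₀ x)‖ ^ 2 + η * ‖u₀ x - a₀ x‖ ^ 2) by linarith) (hψ0 x)
        linarith
      calc ENNReal.ofReal (W (t, x)) ≤ ENNReal.ofReal (W₀ x + (cη * (‖(u t x - a t x) - (u₀ x - a₀ x)‖ ^ 2 * ψ x) + η * W₀ x)) :=
            ENNReal.ofReal_le_ofReal hreal
        _ = _ := by
            have hn1 : 0 ≤ cη * (‖(u t x - a t x) - (u₀ x - a₀ x)‖ ^ 2 * ψ x) := mul_nonneg hcη.le (mul_nonneg (sq_nonneg _) (hψ0 x))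
            have hn2 : 0 ≤ η * W₀ x := mul_nonneg hη.le (hW₀0 x)
            rw [ENNReal.ofReal_add (hW₀0 x) (add_nonneg hn1 hn2), ENNReal.ofReal_add hn1 hn2, hmid x, ENNReal.ofReal_mul hη.le]
    have hpt2 : ∀ x, ENNReal.ofReal (W₀ x) ≤ ENNReal.ofReal (W (t, x)) +
        (ENNReal.ofReal cη * (‖(u t x - a t x) - (u₀ x - a₀ x)‖ₑ ^ 2 * ENNReal.ofReal (ψ x)) +
          ENNReal.ofReal η * ENNReal.ofReal (W₀ x)) := by
      intro x
      have h := (abs_le.1 (hkey x)).1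
      have hW0' : 0 ≤ W (t, x) := mul_nonneg (sq_nonneg _) (hψ0 _)
      have hreal : W₀ x ≤ W (t, x) + (cη * (‖(u t x - a t x) - (u₀ x - a₀ x)‖ ^ 2 * ψ x) + η * W₀ x) := by
        show ‖u₀ x - a₀ x‖ ^ 2 * ψ x ≤ ‖u t x - a t x‖ ^ 2 * ψ x +
          (cη * (‖(u t x - a t x) - (u₀ x - a₀ x)‖ ^ 2 * ψ x) + η * (‖u₀ x - a₀ x‖ ^ 2 * ψ x))
        have := mul_le_mul_of_nonneg_right (show ‖u₀ x - a₀ x‖ ^ 2 ≤ ‖u t x - a t x‖ ^ 2 +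
          (cη * ‖(u t x - a t x) - (u₀ x - a₀ x)‖ ^ 2 + η * ‖u₀ x - a₀ x‖ ^ 2) by linarith) (hψ0 x)
        linarith
      calc ENNReal.ofReal (W₀ x) ≤ ENNReal.ofReal (W (t, x) + (cη * (‖(u t x - a t x) - (u₀ x - a₀ x)‖ ^ 2 * ψ x) + η * W₀ x)) :=
            ENNReal.ofReal_le_ofReal hreal
        _ = _ := by
            have hn1 : 0 ≤ cη * (‖(u t x - a t x) - (u₀ x - a₀ x)‖ ^ 2 * ψ x) := mul_nonneg hcη.le (mul_nonneg (sq_nonneg _) (hψ0 x))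
            have hn2 : 0 ≤ η * W₀ x := mul_nonneg hη.le (hW₀0 x)
            rw [ENNReal.ofReal_add hW0' (add_nonneg hn1 hn2), ENNReal.ofReal_add hn1 hn2, hmid x, ENNReal.ofReal_mul hη.le]
    have hFm2 : AEMeasurable (fun x => ‖(u t x - a t x) - (u₀ x - a₀ x)‖ₑ ^ 2 * ENNReal.ofReal (ψ x)) volume :=
      (hFm.aemeasurable.enorm.pow_const _).mul hψcont.measurable.ennreal_ofReal.aemeasurable
    have hEm : AEMeasurable (fun x => ENNReal.ofReal cη * (‖(u t x - a t x) - (u₀ x - a₀ x)‖ₑ ^ 2 * ENNReal.ofReal (ψ x)) +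
        ENNReal.ofReal η * ENNReal.ofReal (W₀ x)) volume :=
      (hFm2.const_mul _).add (hW₀m.aemeasurable.ennreal_ofReal.const_mul _)
    have hintE : ∫⁻ x, (ENNReal.ofReal cη * (‖(u t x - a t x) - (u₀ x - a₀ x)‖ₑ ^ 2 * ENNReal.ofReal (ψ x)) +
        ENNReal.ofReal η * ENNReal.ofReal (W₀ x)) = E := by
      rw [lintegral_add_left' (hFm2.const_mul _), lintegral_const_mul'' _ hFm2,
        lintegral_const_mul'' _ hW₀m.aemeasurable.ennreal_ofReal]
    have hΛ1 : Λ ≤ Λ₀ + E := by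
      calc Λ ≤ ∫⁻ x, (ENNReal.ofReal (W₀ x) + (ENNReal.ofReal cη * (‖(u t x - a t x) - (u₀ x - a₀ x)‖ₑ ^ 2 * ENNReal.ofReal (ψ x)) +
            ENNReal.ofReal η * ENNReal.ofReal (W₀ x))) := lintegral_mono hpt1
        _ = Λ₀ + E := by rw [lintegral_add_right' _ hEm, hintE]
    have hΛ2 : Λ₀ ≤ Λ + E := by
      calc Λ₀ ≤ ∫⁻ x, (ENNReal.ofReal (W (t, x)) + (ENNReal.ofReal cη * (‖(u t x - a t x) - (u₀ x - a₀ x)‖ₑ ^ 2 * ENNReal.ofReal (ψ x)) +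
            ENNReal.ofReal η * ENNReal.ofReal (W₀ x))) := lintegral_mono hpt2
        _ = Λ + E := by rw [lintegral_add_right' _ hEm, hintE]
    have hΛt : Λ ≠ ⊤ := ne_top_of_le_ne_top (ENNReal.add_ne_top.2 ⟨hΛ₀t, hEt⟩) hΛ1
    -- `∫ W(t) = Λ.toReal`, `L = Λ₀.toReal`
    have hWtm : AEStronglyMeasurable (fun x => W (t, x)) volume := ((hut.sub hat).norm.pow 2).mul hψcont.aestronglyMeasurable
    have hWt0 : ∀ x, 0 ≤ W (t, x) := fun x => mul_nonneg (sq_nonneg _) (hψ0 _)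
    have hintW : ∫ x, W (t, x) = Λ.toReal := integral_eq_lintegral_of_nonneg_ae (Eventually.of_forall hWt0) hWtm
    have hLeq : L = Λ₀.toReal := by rw [hΛ₀L, ENNReal.toReal_ofReal hL0]
    rw [hintW, hLeq]
    -- `|Λ.toReal - Λ₀.toReal| ≤ E.toReal ≤ ε`
    have hE_real : E.toReal ≤ ε := by
      rw [hE, ENNReal.toReal_add (ENNReal.mul_ne_top ENNReal.ofReal_ne_top hJt) (ENNReal.mul_ne_top ENNReal.ofReal_ne_top hΛ₀t),
        ENNReal.toReal_mul, ENNReal.toReal_mul, ENNReal.toReal_ofReal hcη.le, ENNReal.toReal_ofReal hη.le, ← hLeq]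
      have hJreal : J.toReal ≤ 2 * Cψ * (δr + δr) := by
        have h := ENNReal.toReal_mono (ENNReal.mul_ne_top ENNReal.ofReal_ne_top
          (ENNReal.add_ne_top.2 ⟨ENNReal.ofReal_ne_top, ENNReal.ofReal_ne_top⟩)) hJle
        rwa [ENNReal.toReal_mul, ENNReal.toReal_ofReal (by positivity), ← ENNReal.ofReal_add hδr0.le hδr0.le,
          ENNReal.toReal_ofReal (by positivity)] at h
      have h3 : cη * (2 * Cψ * (δr + δr)) ≤ ε / 2 := by
        rw [hδr]
        have e : cη * (2 * Cψ * (ε / (2 * cη * (4 * (Cψ + 1))) + ε / (2 * cη * (4 * (Cψ + 1))))) =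
            ε / 2 * (Cψ / (Cψ + 1)) := by field_simp; ring
        rw [e]
        calc ε / 2 * (Cψ / (Cψ + 1)) ≤ ε / 2 * 1 :=
              mul_le_mul_of_nonneg_left ((div_le_one hCψ1).2 (by linarith)) (by positivity)
          _ = ε / 2 := mul_one _
      calc cη * J.toReal + η * L ≤ cη * (2 * Cψ * (δr + δr)) + ε / 2 := add_le_add (by gcongr) hηL
        _ ≤ ε / 2 + ε / 2 := add_le_add h3 le_rfl
        _ = ε := by ring
    have hfinE : Λ₀ + E ≠ ⊤ := ENNReal.add_ne_top.2 ⟨hΛ₀t, hEt⟩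
    have hfinE' : Λ + E ≠ ⊤ := ENNReal.add_ne_top.2 ⟨hΛt, hEt⟩
    have h1r := ENNReal.toReal_mono hfinE hΛ1
    have h2r := ENNReal.toReal_mono hfinE' hΛ2
    rw [ENNReal.toReal_add hΛ₀t hEt] at h1r
    rw [ENNReal.toReal_add hΛt hEt] at h2r
    rw [abs_le]
    constructor <;> linarith
  -- ## the tested inequality with `Φ = χ(t) ψ(x)`
  have hR₁I : IntegrableOn R₁ (I ×ˢ (univ : Set (EuclideanSpace ℝ (Fin 3)))) volume :=
    integrableOn_strip_of_box hR₁B (fun z hz => by simp only [hR₁, hLK0 _ hz, mul_zero]) measurableSet_Ioo hKc.measurableSet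
  have hR₂I : IntegrableOn R₂ (I ×ˢ (univ : Set (EuclideanSpace ℝ (Fin 3)))) volume :=
    integrableOn_strip_of_box hR₂B (fun z hz => by simp only [hR₂, hgK _ hz, inner_zero_right, mul_zero])
      measurableSet_Ioo hKc.measurableSet
  have hR₃I : IntegrableOn R₃ (I ×ˢ (univ : Set (EuclideanSpace ℝ (Fin 3)))) volume :=
    integrableOn_strip_of_box hR₃B (fun z hz => by simp only [hR₃, hgK _ hz, inner_zero_right, mul_zero])
      measurableSet_Ioo hKc.measurableSet
  have hR₄I : IntegrableOn R₄ (I ×ˢ (univ : Set (EuclideanSpace ℝ (Fin 3)))) volume :=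
    integrableOn_strip_of_box hR₄B (fun z hz => by simp only [hR₄, hψK _ hz, zero_mul]) measurableSet_Ioo hKc.measurableSet
  have hW0 : ∀ z, 0 ≤ W z := fun z => mul_nonneg (sq_nonneg _) (hψ0 _)
  have hD0 : ∀ z, 0 ≤ D z := fun z => mul_nonneg (frobeniusNormSq_nonneg _) (hψ0 _)
  have hiter : ∀ F : ℝ × (EuclideanSpace ℝ (Fin 3)) → ℝ, Integrable F volume → ∫ t, ∫ x, F (t, x) = ∫ z, F z := by
    intro F hF
    have hF' : Integrable F ((volume : Measure ℝ).prod (volume : Measure (EuclideanSpace ℝ (Fin 3)))) := by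
      rwa [← Measure.volume_eq_prod]
    have h := integral_prod F hF'
    rw [← Measure.volume_eq_prod] at h
    exact h.symm
  have H : ∀ χ : ℝ → ℝ, ContDiff ℝ (⊤ : ℕ∞) χ → HasCompactSupport χ → tsupport χ ⊆ Ioo 0 S →
      (∀ t, 0 ≤ χ t) → (∀ t, χ t ≤ 1) →
      2 * ∫ z : ℝ × (EuclideanSpace ℝ (Fin 3)), χ z.1 * D z ≤ ∫ z : ℝ × (EuclideanSpace ℝ (Fin 3)), (deriv χ z.1 * W z + χ z.1 * R z) := by
    intro χ hχ hχc hχS hχ0 hχ1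
    -- `χ = 0`: both sides vanish
    rcases (tsupport χ).eq_empty_or_nonempty with hχe | hχne
    · have hχ0' : ∀ t, χ t = 0 := fun t =>
        image_eq_zero_of_notMem_tsupport (by rw [hχe]; exact notMem_empty _)
      have hχfun : χ = fun _ => 0 := funext hχ0'
      have hdχ : ∀ t, deriv χ t = 0 := fun t => by rw [hχfun, deriv_const]
      simp [hχ0', hdχ]
    -- `[a', b'] ⊇ tsupport χ` inside `(0, S)`
    set a' : ℝ := sInf (tsupport χ) with ha'def
    set b' : ℝ := sSup (tsupport χ) with hb'def
    have hKχ : IsCompact (tsupport χ) := hχc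
    have ha'm : a' ∈ tsupport χ := hKχ.sInf_mem hχne
    have hb'm : b' ∈ tsupport χ := hKχ.sSup_mem hχne
    have ha' : 0 < a' := (hχS ha'm).1
    have hb' : b' < S := (hχS hb'm).2
    have hab : Icc a' b' ⊆ Ioo 0 S := fun t ht => ⟨ha'.trans_le ht.1, ht.2.trans_lt hb'⟩
    have habI : Icc a' b' ×ˢ (univ : Set (EuclideanSpace ℝ (Fin 3))) ⊆ I ×ˢ (univ : Set (EuclideanSpace ℝ (Fin 3))) := Set.prod_mono hab Subset.rfl
    have hχI : tsupport χ ⊆ Icc a' b' := fun t ht => ⟨csInf_le hKχ.bddBelow ht, le_csSup hKχ.bddAbove ht⟩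
    have hχ0' : ∀ t ∉ Icc a' b', χ t = 0 := fun t ht =>
      image_eq_zero_of_notMem_tsupport fun h => ht (hχI h)
    have hdχ0 : ∀ t ∉ Icc a' b', deriv χ t = 0 := by
      intro t ht
      have hnt : t ∉ tsupport χ := fun h => ht (hχI h)
      have h0 : χ =ᶠ[𝓝 t] fun _ => (0 : ℝ) := notMem_tsupport_iff_eventuallyEq.1 hnt
      rw [h0.deriv_eq, deriv_const]
    have hdχc : Continuous (deriv χ) := hχ.continuous_deriv (by simp)
    obtain ⟨Cd, hCd⟩ := hdχc.bounded_above_of_compact_support hχc.deriv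
    have hχb : ∀ t, |χ t| ≤ 1 := fun t => by rw [abs_of_nonneg (hχ0 t)]; exact hχ1 t
    have hdχb : ∀ t, |deriv χ t| ≤ Cd := fun t => (Real.norm_eq_abs _).symm.le.trans (hCd t)
    -- the test function
    set Φ : ℝ → (EuclideanSpace ℝ (Fin 3)) → ℝ := fun t x => χ t * ψ x with hΦdef
    have hΦ : IsSpaceTimeTestOn (slab (EuclideanSpace ℝ (Fin 3)) (Ioo 0 S) isOpen_Ioo) Φ :=
      BradshawTsai2019.isSpaceTimeTestOn_prod_mul isOpen_Ioo isOpen_univ hχ hab hχ0' hψ hψc (subset_univ _)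
    have hΦ0 : ∀ t x, 0 ≤ Φ t x := fun t x => mul_nonneg (hχ0 t) (hψ0 x)
    have hineq := perturbed_local_energy_inequality_slab hT' hu hG hGb hS₀ hS₀₂ hLK hcl hΦ hΦ0
    -- the derivatives of `Φ`
    have hΦt : ∀ t x, timeDeriv Φ t x = deriv χ t * ψ x := fun t x => by
      show deriv (fun s => χ s * ψ x) t = _
      exact deriv_mul_const_field _
    have hψ2 : ContDiff ℝ 2 ψ := hψ.of_le (by norm_cast)
    have hΦL : ∀ t x, (Δ (Φ t)) x = χ t * (Δ ψ) x := fun t x => by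
      show (Δ (fun y => χ t * ψ y)) x = _
      have e : (fun y => χ t * ψ y) = χ t • ψ := rfl
      rw [e, InnerProductSpace.laplacian_smul _ hψ2.contDiffAt, smul_eq_mul]
    have hΦg : ∀ t x, gradient (Φ t) x = χ t • gradient ψ x := fun t x =>
      gradient_const_smul ((hψ.differentiable (by simp)).differentiableAt) (χ t)
    have i0 : ∀ t x, frobeniusNormSq (G t x - fderiv ℝ (a t) x) * Φ t x = χ t * D (t, x) := fun t x => by
      simp only [hD, hΦdef]; ring
    have i1 : ∀ t x, ‖u t x - a t x‖ ^ 2 * (timeDeriv Φ t x + (Δ (Φ t)) x) =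
        deriv χ t * W (t, x) + χ t * R₁ (t, x) := fun t x => by
      rw [hΦt, hΦL]; simp only [hW, hR₁]; ring
    have i2 : ∀ t x, ‖u t x - a t x‖ ^ 2 * ⟪u t x, gradient (Φ t) x⟫ = χ t * R₂ (t, x) := fun t x => by
      rw [hΦg, inner_smul_right]; simp only [hR₂]; ring
    have i3 : ∀ t x, (p t x - pK t x) * ⟪u t x - a t x, gradient (Φ t) x⟫ = χ t * R₃ (t, x) := fun t x => by
      rw [hΦg, inner_smul_right]; simp only [hR₃]; ring
    have i4 : ∀ t x, Φ t x * ⟪fderiv ℝ (a t) x (u t x - a t x), u t x - a t x⟫ = χ t * R₄ (t, x) := fun t x => by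
      simp only [hR₄, hΦdef]; ring
    simp_rw [i0, i1, i2, i3, i4] at hineq
    -- integrability of the weighted densities on `ℝ × ℝ³`
    have jD : Integrable (fun z : ℝ × (EuclideanSpace ℝ (Fin 3)) => χ z.1 * D z) volume :=
      integrable_timeWeight_mul (hDint a' b' ha' hb') hχ.continuous hχb hχ0'
    have jW : Integrable (fun z : ℝ × (EuclideanSpace ℝ (Fin 3)) => deriv χ z.1 * W z) volume :=
      integrable_timeWeight_mul (hWI.mono_set habI) hdχc hdχb hdχ0
    have jR₁ : Integrable (fun z : ℝ × (EuclideanSpace ℝ (Fin 3)) => χ z.1 * R₁ z) volume :=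
      integrable_timeWeight_mul (hR₁I.mono_set habI) hχ.continuous hχb hχ0'
    have jR₂ : Integrable (fun z : ℝ × (EuclideanSpace ℝ (Fin 3)) => χ z.1 * R₂ z) volume :=
      integrable_timeWeight_mul (hR₂I.mono_set habI) hχ.continuous hχb hχ0'
    have jR₃ : Integrable (fun z : ℝ × (EuclideanSpace ℝ (Fin 3)) => χ z.1 * R₃ z) volume :=
      integrable_timeWeight_mul (hR₃I.mono_set habI) hχ.continuous hχb hχ0'
    have jR₄ : Integrable (fun z : ℝ × (EuclideanSpace ℝ (Fin 3)) => χ z.1 * R₄ z) volume :=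
      integrable_timeWeight_mul (hR₄I.mono_set habI) hχ.continuous hχb hχ0'
    -- iterated integrals as product integrals
    have k0 : ∫ t, ∫ x, χ t * D (t, x) = ∫ z : ℝ × (EuclideanSpace ℝ (Fin 3)), χ z.1 * D z := hiter (fun z => χ z.1 * D z) jD
    have k1 : ∫ t, ∫ x, (deriv χ t * W (t, x) + χ t * R₁ (t, x)) =
        ∫ z : ℝ × (EuclideanSpace ℝ (Fin 3)), (deriv χ z.1 * W z + χ z.1 * R₁ z) :=
      hiter (fun z => deriv χ z.1 * W z + χ z.1 * R₁ z) (jW.add jR₁)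
    have k2 : ∫ t, ∫ x, χ t * R₂ (t, x) = ∫ z : ℝ × (EuclideanSpace ℝ (Fin 3)), χ z.1 * R₂ z := hiter (fun z => χ z.1 * R₂ z) jR₂
    have k3 : ∫ t, ∫ x, χ t * R₃ (t, x) = ∫ z : ℝ × (EuclideanSpace ℝ (Fin 3)), χ z.1 * R₃ z := hiter (fun z => χ z.1 * R₃ z) jR₃
    have k4 : ∫ t, ∫ x, χ t * R₄ (t, x) = ∫ z : ℝ × (EuclideanSpace ℝ (Fin 3)), χ z.1 * R₄ z := hiter (fun z => χ z.1 * R₄ z) jR₄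
    rw [k0, k1, k2, k3, k4] at hineq
    have esum : ∫ z : ℝ × (EuclideanSpace ℝ (Fin 3)), (deriv χ z.1 * W z + χ z.1 * R z) =
        (∫ z : ℝ × (EuclideanSpace ℝ (Fin 3)), (deriv χ z.1 * W z + χ z.1 * R₁ z)) + (∫ z : ℝ × (EuclideanSpace ℝ (Fin 3)), χ z.1 * R₂ z) +
          2 * (∫ z : ℝ × (EuclideanSpace ℝ (Fin 3)), χ z.1 * R₃ z) - 2 * ∫ z : ℝ × (EuclideanSpace ℝ (Fin 3)), χ z.1 * R₄ z := by
      have jWR₁ : Integrable (fun z : ℝ × (EuclideanSpace ℝ (Fin 3)) => deriv χ z.1 * W z + χ z.1 * R₁ z) volume := jW.add jR₁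
      have j3 : Integrable (fun z : ℝ × (EuclideanSpace ℝ (Fin 3)) => (deriv χ z.1 * W z + χ z.1 * R₁ z) + χ z.1 * R₂ z) volume :=
        jWR₁.add jR₂
      have j2R₃ : Integrable (fun z : ℝ × (EuclideanSpace ℝ (Fin 3)) => 2 * (χ z.1 * R₃ z)) volume := jR₃.const_mul 2
      have j2R₄ : Integrable (fun z : ℝ × (EuclideanSpace ℝ (Fin 3)) => 2 * (χ z.1 * R₄ z)) volume := jR₄.const_mul 2
      have j4 : Integrable (fun z : ℝ × (EuclideanSpace ℝ (Fin 3)) =>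
          (deriv χ z.1 * W z + χ z.1 * R₁ z) + χ z.1 * R₂ z + 2 * (χ z.1 * R₃ z)) volume := j3.add j2R₃
      have e1 : ∫ z : ℝ × (EuclideanSpace ℝ (Fin 3)), (deriv χ z.1 * W z + χ z.1 * R z) =
          ∫ z : ℝ × (EuclideanSpace ℝ (Fin 3)), ((deriv χ z.1 * W z + χ z.1 * R₁ z) + χ z.1 * R₂ z +
            2 * (χ z.1 * R₃ z) - 2 * (χ z.1 * R₄ z)) :=
        integral_congr_ae (Eventually.of_forall fun z => by simp only [hR]; ring)
      rw [e1, integral_sub j4 j2R₄, integral_add j3 j2R₃, integral_add jWR₁ jR₂, integral_const_mul,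
        integral_const_mul]
    rw [esum]
    exact hineq
  -- ## the slicing lemma
  have hfinal := ae_energy_slice_from_initial (X := (EuclideanSpace ℝ (Fin 3))) hS hWI hRI hW0 hD0 hDm hDint (L := L) hlim H
  simpa only [hW, hD, hR, hR₁, hR₂, hR₃, hR₄] using hfinal

end Literature.Analysis.FluidPDE
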